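import Summits.Ventures.HSemireg.WedgeHankelRecurrenceGaussSymmetricRecurrence

/-!
# Venture HSemireg — **COURANT–FISCHER FOR THE GAUSS NODES**: for the `(t+1)`-point Gauss rule `(μ, x)` of a discrete positive measure `ν` and the Rayleigh quotient
# `R(P) = Σ ν w P² ∕ Σ ν P²` on polynomials of degree `≤ t`, the `k`-th node is `x_k = min {R(P) : P ≠ 0, P(x_j) = 0 (j < k)} = max {R(P) : P ≠ 0, P(x_j) = 0 (j > k)}`, both attained at
# `∏_{j ≠ k} (X − x_j)` (N301 is the case of the extreme nodes, with no vanishing condition)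

HONEST FRAMING. Part of the Lean index of the computation cell `pub-hsemireg` (seat p10 gen 44, Sunday typer «UNIFORM-IN-n»).  Real polynomials and finite sums only; no variety, no cohomology
theory, no sheaf, no Ext group and no semiregularity map is constructed here; nothing here says that HC / HC_CM / HC_AV holds; no Literature fact (unproved `Prop`) is declared or used.  Custodian
versions as in `WedgeHankelSiegelIdeal` (1/3).
SOURCES (cited).  E. Fischer, Monatsh. Math. Phys. 16 (1905) 234–249; R. Courant, Math. Z. 7 (1920) 1–57 (min–max); R. A. Horn, C. R. Johnson, *Matrix Analysis* (2nd ed.) Thm 4.2.6 ∕ 4.2.11;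
G. Szegő, *Orthogonal Polynomials*, §3.4 and Thm 7.72.1 (the Gauss nodes as stationary values of the Rayleigh quotient); G. H. Golub, J. H. Welsch, Math. Comp. 23 (1969) 221–230.
PROOF TYPED HERE.  The one-sided bounds are N320 `gaussNode_mul_sum_sq_le_of_eval_eq_zero_below` ∕ `sum_node_sq_le_gaussNode_mul_of_eval_eq_zero_above`; the extremiser `∏_{j≠k}(X − x_j)` lives on the
single node `x_k` under the rule, so its quotient is `x_k`.
DEDUP DISCLOSURE (`rg -n 'IsLeast|IsGreatest|rayleigh' Summits/Ventures/HSemireg`, 2026-09-03): N301 `gaussNode_last_isGreatest_rayleigh` is the case `k = t` ∕ `k = 0` without vanishing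
conditions; the interior nodes are new.  The 3 names below: 0 hits tree-wide.

WHAT IS IN THE TREE.  N320 (the two one-sided bounds), N263 `sum_mul_eval_eq_of_moments_eq`, N265 `gauss_weight_pos`, N273 `sum_mul_eval_sq_pos_of_natDegree_lt`.
THIS FILE (namespace `Summit.Ventures.HSemireg.Wedge.HankelOuter` continued; CHAINED on N340 (import only), N320; 0 definitions):
* §1106 `nodePoly_erase_spec` (`∏_{j≠k}(X − x_j)`: monic, degree `t`, vanishes at `x_j` (`j ≠ k`), `Σ ν w T² = x_k Σ ν T²`, `Σ ν T² > 0`), **`gaussNode_isLeast_rayleigh`** (`x_k = min R(P)` over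
  `P ≠ 0`, `deg P ≤ t`, `P(x_j) = 0` for `j < k`), **`gaussNode_isGreatest_rayleigh`** (`x_k = max R(P)` over `P ≠ 0`, `deg P ≤ t`, `P(x_j) = 0` for `j > k`).
CAVEATS.  Discrete positive measures with at least `t + 1` points.  Nothing Ext-side.  New names only.
-/

open Module Polynomial
open scoped Matrix Polynomial

namespace Summit.Ventures.HSemireg.Wedge.HankelOuter

/-! ## §1106. Min–max characterisation of every Gauss node -/

/-- **The extremiser `T_k = ∏_{j ≠ k} (X − x_j)`**: monic of degree `t`, `T_k(x_j) = 0` for `j ≠ k`, and under the Gauss rule `Σ_l ν_l w_l T_k(w_l)² = x_k Σ_l ν_l T_k(w_l)²` with `Σ_l ν_l T_k(w_l)² > 0`.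
[this file, §1106] -/
theorem nodePoly_erase_spec {t N : ℕ} {ν w : Fin N → ℝ} (hν : ∀ l, 0 < ν l) (hw : Function.Injective w) (hN : t + 1 ≤ N) {μ x : Fin (t + 1) → ℝ}
    (hmom : ∀ p, p ≤ 2 * t + 1 → ∑ j, μ j * x j ^ p = ∑ l, ν l * w l ^ p) (k : Fin (t + 1)) :
    (∏ j ∈ Finset.univ.erase k, (Polynomial.X - C (x j))).Monic ∧ (∏ j ∈ Finset.univ.erase k, (Polynomial.X - C (x j))).natDegree = t ∧
      (∀ j, j ≠ k → (∏ j ∈ Finset.univ.erase k, (Polynomial.X - C (x j))).eval (x j) = 0) ∧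
      ∑ l, ν l * (w l * ((∏ j ∈ Finset.univ.erase k, (Polynomial.X - C (x j))).eval (w l)) ^ 2) = x k * ∑ l, ν l * ((∏ j ∈ Finset.univ.erase k, (Polynomial.X - C (x j))).eval (w l)) ^ 2 ∧
      0 < ∑ l, ν l * ((∏ j ∈ Finset.univ.erase k, (Polynomial.X - C (x j))).eval (w l)) ^ 2 := by
  set T := ∏ j ∈ Finset.univ.erase k, (Polynomial.X - C (x j)) with hT
  have hm : T.Monic := monic_prod_of_monic _ _ fun j _ => monic_X_sub_C _
  have hd : T.natDegree = t := by
    rw [hT, natDegree_prod_of_monic _ _ (fun j _ => monic_X_sub_C _)]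
    simp only [natDegree_X_sub_C, Finset.sum_const, Finset.card_erase_of_mem (Finset.mem_univ k), Finset.card_univ, Fintype.card_fin, smul_eq_mul, mul_one, Nat.add_sub_cancel]
  have hz : ∀ j, j ≠ k → T.eval (x j) = 0 := fun j hj => by
    rw [hT, eval_prod]; exact Finset.prod_eq_zero (Finset.mem_erase.2 ⟨hj, Finset.mem_univ j⟩) (by rw [eval_sub, eval_X, eval_C, sub_self])
  have hmom' : ∀ p, p < 2 * t + 2 → ∑ j, μ j * x j ^ p = ∑ l, ν l * w l ^ p := fun p hp => hmom p (by omega)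
  have hA : ∑ l, ν l * (T.eval (w l)) ^ 2 = ∑ j, μ j * (T.eval (x j)) ^ 2 := by
    have h := sum_mul_eval_eq_of_moments_eq hmom' (F := T ^ 2) (natDegree_pow_le.trans_lt (by rw [hd]; omega))
    simp only [eval_pow] at h; exact h.symm
  have hB : ∑ l, ν l * (w l * (T.eval (w l)) ^ 2) = ∑ j, μ j * (x j * (T.eval (x j)) ^ 2) := by
    have h := sum_mul_eval_eq_of_moments_eq hmom' (F := Polynomial.X * T ^ 2)
      ((natDegree_mul_le.trans (add_le_add natDegree_X_le natDegree_pow_le)).trans_lt (by rw [hd]; omega))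
    simp only [eval_mul, eval_X, eval_pow] at h; exact h.symm
  have hA1 : ∑ j, μ j * (T.eval (x j)) ^ 2 = μ k * (T.eval (x k)) ^ 2 :=
    Finset.sum_eq_single k (fun j _ hj => by rw [hz j hj]; ring) (fun h => absurd (Finset.mem_univ k) h)
  have hB1 : ∑ j, μ j * (x j * (T.eval (x j)) ^ 2) = μ k * (x k * (T.eval (x k)) ^ 2) :=
    Finset.sum_eq_single k (fun j _ hj => by rw [hz j hj]; ring) (fun h => absurd (Finset.mem_univ k) h)
  refine ⟨hm, hd, hz, by rw [hA, hB, hA1, hB1]; ring, sum_mul_eval_sq_pos_of_natDegree_lt hν hw hm.ne_zero (by rw [hd]; omega)⟩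

/-- **COURANT–FISCHER, LOWER FORM: `x_k` is the LEAST value of `Σ ν w P² ∕ Σ ν P²` over non-zero `P` of degree `≤ t` with `P(x_j) = 0` for all `j < k`.** [Fischer 1905; Courant 1920;
Horn–Johnson Thm 4.2.11; Szegő §3.4; this file, §1106] -/
theorem gaussNode_isLeast_rayleigh {t N : ℕ} {ν w : Fin N → ℝ} (hν : ∀ l, 0 < ν l) (hw : Function.Injective w) (hN : t + 1 ≤ N) {μ x : Fin (t + 1) → ℝ} (hx : StrictMono x)
    (hmom : ∀ p, p ≤ 2 * t + 1 → ∑ j, μ j * x j ^ p = ∑ l, ν l * w l ^ p) (k : Fin (t + 1)) :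
    IsLeast {r : ℝ | ∃ P : ℝ[X], P ≠ 0 ∧ P.natDegree ≤ t ∧ (∀ j, j < k → P.eval (x j) = 0) ∧ r = (∑ l, ν l * (w l * (P.eval (w l)) ^ 2)) / ∑ l, ν l * (P.eval (w l)) ^ 2} (x k) := by
  have hμ : ∀ j, 0 ≤ μ j := fun j => (gauss_weight_pos hx.injective hν hw hN (fun p hp => hmom p (by omega)) j).le
  obtain ⟨hm, hd, hz, hR, hpos⟩ := nodePoly_erase_spec hν hw hN hmom k
  refine ⟨⟨_, hm.ne_zero, hd.le, fun j hj => hz j hj.ne, by rw [hR, mul_div_assoc, div_self hpos.ne', mul_one]⟩, ?_⟩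
  rintro r ⟨P, hP0, hPd, hPz, rfl⟩
  have hden : 0 < ∑ l, ν l * (P.eval (w l)) ^ 2 := sum_mul_eval_sq_pos_of_natDegree_lt hν hw hP0 (by omega)
  rw [le_div_iff₀ hden]
  exact gaussNode_mul_sum_sq_le_of_eval_eq_zero_below hx hμ hmom hPd k hPz

/-- **COURANT–FISCHER, UPPER FORM: `x_k` is the GREATEST value of `Σ ν w P² ∕ Σ ν P²` over non-zero `P` of degree `≤ t` with `P(x_j) = 0` for all `j > k`.** [Fischer 1905; Courant 1920;
Horn–Johnson Thm 4.2.11; Szegő Thm 7.72.1; this file, §1106] -/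
theorem gaussNode_isGreatest_rayleigh {t N : ℕ} {ν w : Fin N → ℝ} (hν : ∀ l, 0 < ν l) (hw : Function.Injective w) (hN : t + 1 ≤ N) {μ x : Fin (t + 1) → ℝ} (hx : StrictMono x)
    (hmom : ∀ p, p ≤ 2 * t + 1 → ∑ j, μ j * x j ^ p = ∑ l, ν l * w l ^ p) (k : Fin (t + 1)) :
    IsGreatest {r : ℝ | ∃ P : ℝ[X], P ≠ 0 ∧ P.natDegree ≤ t ∧ (∀ j, k < j → P.eval (x j) = 0) ∧ r = (∑ l, ν l * (w l * (P.eval (w l)) ^ 2)) / ∑ l, ν l * (P.eval (w l)) ^ 2} (x k) := by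
  have hμ : ∀ j, 0 ≤ μ j := fun j => (gauss_weight_pos hx.injective hν hw hN (fun p hp => hmom p (by omega)) j).le
  obtain ⟨hm, hd, hz, hR, hpos⟩ := nodePoly_erase_spec hν hw hN hmom k
  refine ⟨⟨_, hm.ne_zero, hd.le, fun j hj => hz j hj.ne', by rw [hR, mul_div_assoc, div_self hpos.ne', mul_one]⟩, ?_⟩
  rintro r ⟨P, hP0, hPd, hPz, rfl⟩
  have hden : 0 < ∑ l, ν l * (P.eval (w l)) ^ 2 := sum_mul_eval_sq_pos_of_natDegree_lt hν hw hP0 (by omega)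
  rw [div_le_iff₀ hden]
  exact sum_node_sq_le_gaussNode_mul_of_eval_eq_zero_above hx hμ hmom hPd k hPz

end Summit.Ventures.HSemireg.Wedge.HankelOuter
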